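import Literature.MathematicalPhysics.QuantumFieldTheory.Balaban1983to89.BlockAveraging
import Literature.MathematicalPhysics.QuantumFieldTheory.Balaban1983to89.T4ExpWindowSmallField
import Literature.MathematicalPhysics.QuantumFieldTheory.Balaban1983to89.T4HaarSU2Translate
import Literature.MathematicalPhysics.QuantumFieldTheory.Balaban1983to89.T4WilsonGaugeFlatDirection
import HarnessLib

/-!
# Letters for the uniform flux-sector certificate: the torus `θ ↦ exp(ι θω)` in `SU(2)`, abelian holonomies as phase sums,
# the area sum of a lattice walk modulo the period, and the centraliser of the torus

Cell `ym3-torus` (YM ladder rung R3 = continuum SU(2) Yang–Mills on the three-torus — a RUNG, NOT the Clay problem), width seat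
`ym3-torus-px8` gen 6; crux `UnitScaleTilt.HistoryTailL` (stmt-QuantumFields-19936), `--supports` only (helper).  These are the
elementary letters consumed by `CovariantDischargeUniformFluxAverages` (the kernel half of the located corner of the registered stub
`SandwichDischarge.stub_sandwichSweepGap`, cell bus 2026-08-29, 19936 evidence #53, ★★OWNER RULING №25 (d)):

* §1 the one-parameter subgroup `θ ↦ expPoint (θ • ω)` (`T4HaarSU2ExpChart.expPoint`, `‖ω‖ = 1`): additivity (`expPoint_add_smul`,
  through `su2Quat` and `exp_add_of_commute` in `ℍ`), `2π`-periodicity (`expPoint_two_pi_mul_int_smul`), `dist1 = 2|sin(θ/2)|`;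
* §2 ABELIAN HOLONOMY: for a configuration `U b = exp(ι φ_b ω)` the transport along any step list is `exp(ι (Σ ±φ) ω)`
  (`holAt_eq_expPoint_sum`); along the walk of a word the constant part of the phase is `Σ_μ c_μ·netDisp_μ` (`sum_walk_const`), and the
  AREA SUM (signed sum of the `μ₀`-coordinates at the `μ₁`-steps) read in `ZMod N` changes under a change of base point by
  `(x μ₀ − x′ μ₀)·netDisp_{μ₁}` (`areaSum_sub_areaSum`) — so for words closed in direction `μ₁` the INTEGER area sums from two base
  points differ by a multiple of the site count (`areaSumZ_sub_dvd`): translation invariance of abelian loop variables on the discrete torus;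
  §2b the phase sums of AFFINE bond phases `c_μ + [μ = μ₁]·α·(x μ₀).val` (`sum_phase_eq`, `sum_phase_line`) and the propagation of the
  flux quantisation `αN_j ∈ 2πℤ ⇒ (L²α)N_{j+1} ∈ 2πℤ` (`quant_succ`);
* §3 the axis `e₀`: `su2Quat (exp(ι θe₀)) = cos θ + sin θ·i`, and THE CENTRALISER OF THE TORUS IS THE TORUS
  (`exists_eq_expPoint_of_commute`: an element of `SU(2)` commuting with the quaternion `i` is `exp(ι θe₀)`).

Elementary algebra over the tree's definitions ([folklore]); nothing of the crux, the stub, the rung R3, d = 4, a continuum limit or a mass gap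
is proved here.  YM₃ on T³ is rung R3 of the programme, NOT the Clay problem.
References: T. Bałaban, CMP **109** (1987) 249–301 [Balaban1987RG1] ((0.4) p.253 — the loop words whose area sums §2 controls).
-/

noncomputable section

open scoped BigOperators Real Quaternion
open NormedSpace

namespace Summit.QuantumFields.YangMills.Theorems.CovariantDischargeUniformFluxLetters

open Literature.MathematicalPhysics.QuantumFieldTheory.Balaban1983to89
open Literature.MathematicalPhysics.QuantumLattice (su2Quat quatToSU2 quatToSU2_su2Quat norm_su2Quat su2Quat_ne_zero)
open T4CubeChartGnomonic (SU2)
open T4HaarSU2ExpChart (imQuat imQuat_apply exp_imQuat_smul expPoint su2Quat_expPoint expPoint_zero)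
open T4HaarSU2Translate (su2Quat_mul su2Quat_one)
open T4ExpWindowSmallField (dist1_expPoint_eq)
open T4Continuum (Letter LStep walk walkEnd holAt netDisp holAt_nil holAt_cons netDisp_cons)
open T4WilsonGaugeFlatDirection (su2Quat_injective)

/-! ## §1 The one-parameter subgroup `θ ↦ exp(ι θω)` of `SU(2)` along a unit vector `ω` -/

section Torus

variable {ω : EuclideanSpace ℝ (Fin 3)}

/-- The quaternions `ι(aω)` and `ι(bω)` commute. [folklore] -/
theorem commute_imQuat_smul (a b : ℝ) (ω : EuclideanSpace ℝ (Fin 3)) : Commute (imQuat (a • ω)) (imQuat (b • ω)) := by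
  rw [map_smul, map_smul]
  exact ((Commute.refl (imQuat ω)).smul_left a).smul_right b

/-- **ONE-PARAMETER SUBGROUP**: `exp(ι (a+b)ω) = exp(ι aω)·exp(ι bω)` in `SU(2)`. [folklore] -/
theorem expPoint_add_smul (a b : ℝ) (ω : EuclideanSpace ℝ (Fin 3)) :
    expPoint ((a + b) • ω) = expPoint (a • ω) * expPoint (b • ω) := by
  letI : NormedAlgebra ℚ ℍ := NormedAlgebra.restrictScalars ℚ ℝ ℍ
  apply su2Quat_injective
  rw [su2Quat_mul, su2Quat_expPoint, su2Quat_expPoint, su2Quat_expPoint, add_smul, map_add,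
    exp_add_of_commute (commute_imQuat_smul a b ω)]

/-- `exp(ι 0) = 1`. [folklore] -/
theorem expPoint_zero_smul (ω : EuclideanSpace ℝ (Fin 3)) : expPoint ((0 : ℝ) • ω) = 1 := by
  rw [zero_smul, expPoint_zero]

/-- `exp(ι (−a)ω) = exp(ι aω)⁻¹`. [folklore] -/
theorem expPoint_neg_smul (a : ℝ) (ω : EuclideanSpace ℝ (Fin 3)) : expPoint ((-a) • ω) = (expPoint (a • ω))⁻¹ := by
  rw [eq_inv_iff_mul_eq_one, ← expPoint_add_smul, neg_add_cancel, expPoint_zero_smul]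

/-- `θ ↦ exp(ι θω)` as a list product: `exp(ι (Σ l)ω) = Π exp(ι l_i ω)`. [folklore] -/
theorem expPoint_list_sum_smul (ω : EuclideanSpace ℝ (Fin 3)) :
    ∀ l : List ℝ, expPoint (l.sum • ω) = (l.map fun a => expPoint (a • ω)).prod
  | [] => by rw [List.sum_nil, List.map_nil, List.prod_nil, expPoint_zero_smul]
  | a :: l => by rw [List.sum_cons, List.map_cons, List.prod_cons, expPoint_add_smul, expPoint_list_sum_smul ω l]

/-- **PERIODICITY**: for a unit vector `ω`, `exp(ι 2πk ω) = 1` (`k ∈ ℤ`). [folklore] -/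
theorem expPoint_two_pi_mul_int_smul (hω : ‖ω‖ = 1) (k : ℤ) : expPoint ((2 * π * k) • ω) = 1 := by
  apply su2Quat_injective
  rw [su2Quat_expPoint, su2Quat_one, exp_imQuat_smul hω]
  have hc : Real.cos (2 * π * k) = 1 := by
    rw [show (2 * π * k : ℝ) = (k : ℤ) * (2 * π) by ring]; exact Real.cos_int_mul_two_pi k
  have hs : Real.sin (2 * π * k) = 0 := by
    have h := Real.sin_int_mul_pi (2 * k)
    rwa [show ((2 * k : ℤ) : ℝ) * π = 2 * π * k by push_cast; ring] at h
  rw [hc, hs, zero_smul, add_zero, Quaternion.coe_one]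

/-- Periodicity in the usable form: phases differing by `2πk` give the same group element. [folklore] -/
theorem expPoint_smul_eq_of_sub_eq (hω : ‖ω‖ = 1) {a b : ℝ} (k : ℤ) (h : a - b = 2 * π * k) :
    expPoint (a • ω) = expPoint (b • ω) := by
  rw [show a = b + 2 * π * k by linarith, expPoint_add_smul, expPoint_two_pi_mul_int_smul hω, mul_one]

/-- `dist1 (exp(ι θω)) = 2|sin(θ/2)|` for a unit vector `ω`. [folklore] -/
theorem dist1_expPoint_smul (hω : ‖ω‖ = 1) (θ : ℝ) : dist1 (expPoint (θ • ω)) = 2 * |Real.sin (θ / 2)| := by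
  rw [dist1_expPoint_eq, norm_smul, hω, mul_one, Real.norm_eq_abs]
  rcases abs_choice θ with h | h
  · rw [h]
  · rw [h, neg_div, Real.sin_neg, abs_neg]

end Torus

/-! ## §2 Abelian configurations along `ω`: holonomies are phase sums -/

section Abelian

variable {P : Params} {j : ℕ} {ω : EuclideanSpace ℝ (Fin 3)}

/-- **ABELIAN HOLONOMY**: if every bond variable is `exp(ι φ_b ω)` then the transport along any step list is
`exp(ι (Σ ±φ) ω)`. [folklore] -/
theorem holAt_eq_expPoint_sum (φ : PBond P j → ℝ) {U : GaugeField P j SU2} (hU : ∀ b, U b = expPoint (φ b • ω)) :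
    ∀ γ : List (LStep P j),
      holAt U γ = expPoint ((γ.map fun s => if s.fwd then φ s.bond else -(φ s.bond)).sum • ω)
  | [] => by rw [holAt_nil, List.map_nil, List.sum_nil, expPoint_zero_smul]
  | s :: γ => by
    rw [holAt_cons, List.map_cons, List.sum_cons, expPoint_add_smul, holAt_eq_expPoint_sum φ hU γ, hU s.bond]
    cases s.fwd
    · rw [if_neg (by decide), if_neg (by decide), expPoint_neg_smul]
    · rw [if_pos rfl, if_pos rfl]

/-- The constant part of a phase sum along a walk is `Σ_μ c_μ·netDisp_μ`. [folklore] -/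
theorem sum_walk_const (c : Fin P.d → ℝ) :
    ∀ (x : Site P j) (w : List (Letter P.d)),
      ((walk x w).map fun s => if s.fwd then c s.bond.dir else -(c s.bond.dir)).sum = ∑ μ, c μ * (netDisp w μ : ℝ)
  | x, [] => by simp [walk, netDisp]
  | x, (μ, true) :: w => by
    rw [show walk x ((μ, true) :: w) = ⟨⟨x, μ⟩, true⟩ :: walk (x.shift μ) w from rfl, List.map_cons, List.sum_cons,
      sum_walk_const c (x.shift μ) w]
    simp only [netDisp_cons, if_true, Int.cast_add, Int.cast_ite, Int.cast_one, Int.cast_zero, mul_add,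
      Finset.sum_add_distrib, mul_ite, mul_one, mul_zero]
    rw [Finset.sum_ite_eq Finset.univ μ, if_pos (Finset.mem_univ _)]
  | x, (μ, false) :: w => by
    rw [show walk x ((μ, false) :: w) = ⟨⟨x.unshift μ, μ⟩, false⟩ :: walk (x.unshift μ) w from rfl, List.map_cons,
      List.sum_cons, sum_walk_const c (x.unshift μ) w]
    simp only [netDisp_cons, Bool.false_eq_true, if_false, Int.cast_add, Int.cast_ite, Int.cast_one, Int.cast_zero,
      Int.cast_neg, mul_add, Finset.sum_add_distrib, mul_ite, mul_neg, mul_one, mul_zero]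
    rw [Finset.sum_ite_eq Finset.univ μ, if_pos (Finset.mem_univ _)]

variable (μ₀ μ₁ : Fin P.d)

/-- **THE AREA SUM IN `ZMod N`**: along the walk of `w` from `x`, the signed sum of the `μ₀`-coordinates at the `μ₁`-steps,
read in `ZMod N`, changes under a change of base point by `(x μ₀ − x′ μ₀)·netDisp_{μ₁}(w)`. [folklore] -/
theorem areaSum_sub_areaSum (h01 : μ₀ ≠ μ₁) :
    ∀ (w : List (Letter P.d)) (x x' : Site P j),
      ((walk x w).map fun s => if s.bond.dir = μ₁ then (if s.fwd then s.bond.src μ₀ else -(s.bond.src μ₀)) else 0).sum -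
        ((walk x' w).map fun s => if s.bond.dir = μ₁ then (if s.fwd then s.bond.src μ₀ else -(s.bond.src μ₀)) else 0).sum =
        (x μ₀ - x' μ₀) * (netDisp w μ₁ : ZMod (P.sitesPerDir j))
  | [], x, x' => by simp [walk, netDisp]
  | (μ, true) :: w, x, x' => by
    rw [show walk x ((μ, true) :: w) = ⟨⟨x, μ⟩, true⟩ :: walk (x.shift μ) w from rfl,
      show walk x' ((μ, true) :: w) = ⟨⟨x', μ⟩, true⟩ :: walk (x'.shift μ) w from rfl]
    simp only [List.map_cons, List.sum_cons, if_true, netDisp_cons, Int.cast_add, Int.cast_ite, Int.cast_one,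
      Int.cast_zero]
    have ih := areaSum_sub_areaSum h01 w (x.shift μ) (x'.shift μ)
    have hsh : (x.shift μ) μ₀ - (x'.shift μ) μ₀ = x μ₀ - x' μ₀ := by
      by_cases h : μ₀ = μ
      · subst h; simp [Site.shift]
      · simp [Site.shift, Function.update_of_ne h]
    rw [hsh] at ih
    by_cases hμ : μ = μ₁
    · rw [if_pos hμ, if_pos hμ, if_pos hμ]; linear_combination ih
    · rw [if_neg hμ, if_neg hμ, if_neg hμ]; linear_combination ih
  | (μ, false) :: w, x, x' => by
    rw [show walk x ((μ, false) :: w) = ⟨⟨x.unshift μ, μ⟩, false⟩ :: walk (x.unshift μ) w from rfl,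
      show walk x' ((μ, false) :: w) = ⟨⟨x'.unshift μ, μ⟩, false⟩ :: walk (x'.unshift μ) w from rfl]
    simp only [List.map_cons, List.sum_cons, Bool.false_eq_true, if_false, netDisp_cons, Int.cast_add, Int.cast_ite,
      Int.cast_one, Int.cast_zero, Int.cast_neg]
    have ih := areaSum_sub_areaSum h01 w (x.unshift μ) (x'.unshift μ)
    have hsh : (x.unshift μ) μ₀ - (x'.unshift μ) μ₀ = x μ₀ - x' μ₀ := by
      by_cases h : μ₀ = μ
      · subst h; simp [Site.unshift]
      · simp [Site.unshift, Function.update_of_ne h]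
    rw [hsh] at ih
    by_cases hμ : μ = μ₁
    · subst hμ
      have hs : (x.unshift μ) μ₀ = x μ₀ := by simp [Site.unshift, Function.update_of_ne h01]
      have hs' : (x'.unshift μ) μ₀ = x' μ₀ := by simp [Site.unshift, Function.update_of_ne h01]
      rw [if_pos rfl, if_pos rfl, if_pos rfl, hs, hs']; linear_combination ih
    · rw [if_neg hμ, if_neg hμ, if_neg hμ]; linear_combination ih

/-- The same area sum with INTEGER labels (`val`), cast to `ZMod N`, is the `ZMod N` area sum. [folklore] -/
theorem intCast_areaSumZ (γ : List (LStep P j)) :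
    (Int.cast (R := ZMod (P.sitesPerDir j))
        (γ.map (fun s => if s.bond.dir = μ₁ then (if s.fwd then ((s.bond.src μ₀).val : ℤ) else -((s.bond.src μ₀).val : ℤ))
          else 0)).sum) =
      (γ.map (fun s => if s.bond.dir = μ₁ then (if s.fwd then s.bond.src μ₀ else -(s.bond.src μ₀)) else 0)).sum := by
  induction γ with
  | nil => simp
  | cons s γ ih =>
    simp only [List.map_cons, List.sum_cons, Int.cast_add, ih]
    congr 1
    split_ifs <;> simp

/-- **TRANSLATION INVARIANCE MODULO THE PERIOD**: for a word closed in direction `μ₁`, the integer area sums from two base points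
differ by a multiple of the site count `N`. [folklore] -/
theorem areaSumZ_sub_dvd (h01 : μ₀ ≠ μ₁) (w : List (Letter P.d)) (hw : netDisp w μ₁ = 0) (x x' : Site P j) :
    (P.sitesPerDir j : ℤ) ∣
      ((walk x w).map (fun s => if s.bond.dir = μ₁ then
          (if s.fwd then ((s.bond.src μ₀).val : ℤ) else -((s.bond.src μ₀).val : ℤ)) else 0)).sum -
      ((walk x' w).map (fun s => if s.bond.dir = μ₁ then
          (if s.fwd then ((s.bond.src μ₀).val : ℤ) else -((s.bond.src μ₀).val : ℤ)) else 0)).sum := by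
  rw [← ZMod.intCast_zmod_eq_zero_iff_dvd, Int.cast_sub, intCast_areaSumZ, intCast_areaSumZ,
    areaSum_sub_areaSum μ₀ μ₁ h01, hw, Int.cast_zero, mul_zero]

end Abelian


/-! ## §2b Phase sums of AFFINE bond phases `c_μ + [μ = μ₁]·α·(x μ₀).val` -/

section AffinePhases

variable {P : Params} {j : ℕ} {μ₀ μ₁ : Fin P.d} {α : ℝ} {c : Fin P.d → ℝ}

/-- The phase sum of an affine configuration along a step list splits into the constant part and `α` times the INTEGER area sum.
[folklore] -/
theorem sum_phase_eq (μ₀ μ₁ : Fin P.d) (α : ℝ) (c : Fin P.d → ℝ) (γ : List (LStep P j)) :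
    (γ.map (fun s => if s.fwd then (c s.bond.dir + if s.bond.dir = μ₁ then α * ((s.bond.src μ₀).val : ℝ) else 0)
        else -(c s.bond.dir + if s.bond.dir = μ₁ then α * ((s.bond.src μ₀).val : ℝ) else 0))).sum =
      (γ.map (fun s => if s.fwd then c s.bond.dir else -(c s.bond.dir))).sum +
        α * (((γ.map (fun s => if s.bond.dir = μ₁ then
          (if s.fwd then ((s.bond.src μ₀).val : ℤ) else -((s.bond.src μ₀).val : ℤ)) else 0)).sum : ℤ) : ℝ) := by
  induction γ with
  | nil => simp
  | cons s γ ih =>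
    simp only [List.map_cons, List.sum_cons, ih, Int.cast_add]
    split_ifs <;> push_cast <;> ring

/-- The phase sum along the straight line of `n` steps `+e_μ`. [folklore] -/
theorem sum_phase_line (h01 : μ₀ ≠ μ₁) (μ : Fin P.d) : ∀ (n : ℕ) (x : Site P j),
    ((walk x (List.replicate n (μ, true))).map (fun s => if s.fwd then
        (c s.bond.dir + if s.bond.dir = μ₁ then α * ((s.bond.src μ₀).val : ℝ) else 0)
        else -(c s.bond.dir + if s.bond.dir = μ₁ then α * ((s.bond.src μ₀).val : ℝ) else 0))).sum =
      n * (c μ + if μ = μ₁ then α * ((x μ₀).val : ℝ) else 0)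
  | 0, x => by simp [walk]
  | n + 1, x => by
    rw [List.replicate_succ, show walk x ((μ, true) :: List.replicate n (μ, true)) =
      ⟨⟨x, μ⟩, true⟩ :: walk (x.shift μ) (List.replicate n (μ, true)) from rfl, List.map_cons, List.sum_cons,
      sum_phase_line h01 μ n (x.shift μ)]
    simp only [if_true]
    by_cases hμ : μ = μ₁
    · subst hμ
      have : (x.shift μ) μ₀ = x μ₀ := by simp [Site.shift, Function.update_of_ne h01]
      simp only [if_true, this]; push_cast; ring
    · simp only [hμ, if_false]; push_cast; ring

/-- The flux quantisation propagates: `αN_j ∈ 2πℤ ⇒ (L²α)N_{j+1} ∈ 2πℤ` (`N_j = L·N_{j+1}`). [folklore] -/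
theorem quant_succ (hj : j + 1 ≤ P.m + P.K) (hN : ∃ n : ℤ, α * (P.sitesPerDir j : ℝ) = 2 * π * n) :
    ∃ n : ℤ, (α * (P.L : ℝ) ^ 2) * (P.sitesPerDir (j + 1) : ℝ) = 2 * π * n := by
  obtain ⟨n, hn⟩ := hN
  refine ⟨n * P.L, ?_⟩
  rw [P.sitesPerDir_eq_mul_succ hj] at hn
  push_cast at hn ⊢
  linear_combination (P.L : ℝ) * hn

end AffinePhases

/-! ## §3 The axis `e₀` and the centraliser of its torus in `SU(2)` -/

section Axis

/-- `‖e₀‖ = 1`. [folklore] -/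
private theorem norm_e0 : ‖(EuclideanSpace.single (0 : Fin 3) (1 : ℝ))‖ = 1 := by
  simp

/-- `ι e₀` is the quaternion `i`. [folklore] -/
theorem imQuat_e0 : imQuat (EuclideanSpace.single (0 : Fin 3) (1 : ℝ)) = ⟨0, 1, 0, 0⟩ := by
  rw [imQuat_apply]
  ext <;> simp

/-- `su2Quat (exp(ι θe₀)) = cos θ + sin θ·i`. [folklore] -/
theorem su2Quat_expPoint_e0 (θ : ℝ) :
    su2Quat (expPoint (θ • EuclideanSpace.single (0 : Fin 3) (1 : ℝ))) = ⟨Real.cos θ, Real.sin θ, 0, 0⟩ := by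
  rw [su2Quat_expPoint, exp_imQuat_smul norm_e0, imQuat_e0]
  ext <;> simp

/-- **THE CENTRALISER OF THE TORUS IS THE TORUS**: an element of `SU(2)` commuting with `exp(ι (π/2) e₀)` (the quaternion `i`) lies
on the one-parameter subgroup `θ ↦ exp(ι θe₀)`. [folklore] -/
theorem exists_eq_expPoint_of_commute (g : SU2)
    (hg : g * expPoint ((π / 2) • EuclideanSpace.single (0 : Fin 3) (1 : ℝ)) =
      expPoint ((π / 2) • EuclideanSpace.single (0 : Fin 3) (1 : ℝ)) * g) :
    ∃ θ : ℝ, g = expPoint (θ • EuclideanSpace.single (0 : Fin 3) (1 : ℝ)) := by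
  set q := su2Quat g with hq
  have hI : su2Quat (expPoint ((π / 2) • EuclideanSpace.single (0 : Fin 3) (1 : ℝ))) = ⟨0, 1, 0, 0⟩ := by
    rw [su2Quat_expPoint_e0, Real.cos_pi_div_two, Real.sin_pi_div_two]
  have hc : q * ⟨0, 1, 0, 0⟩ = ⟨0, 1, 0, 0⟩ * q := by
    have := congrArg su2Quat hg
    rwa [su2Quat_mul, su2Quat_mul, hI] at this
  have hJ : q.imJ = 0 := by
    have := congrArg QuaternionAlgebra.imK hc
    simp at this
    linarith
  have hK : q.imK = 0 := by
    have := congrArg QuaternionAlgebra.imJ hc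
    simp at this
    linarith
  have hn : q.re ^ 2 + q.imI ^ 2 = 1 := by
    have h1 : ‖q‖ = 1 := norm_su2Quat g
    have h2 : ‖q‖ * ‖q‖ = Quaternion.normSq q := (Quaternion.normSq_eq_norm_mul_self q).symm
    rw [h1, mul_one, Quaternion.normSq_def'] at h2
    rw [hJ, hK] at h2
    nlinarith [h2]
  set z : ℂ := ⟨q.re, q.imI⟩ with hz
  have hz1 : ‖z‖ = 1 := by
    rw [Complex.norm_eq_sqrt_sq_add_sq]
    simp only [hz]
    rw [hn, Real.sqrt_one]
  have hz0 : z ≠ 0 := by intro h; rw [h, norm_zero] at hz1; exact zero_ne_one hz1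
  refine ⟨Complex.arg z, su2Quat_injective ?_⟩
  rw [su2Quat_expPoint_e0, Complex.cos_arg hz0, Complex.sin_arg, hz1, div_one, div_one]
  rw [← hq]
  ext <;> simp [hz, hJ, hK]

end Axis

end Summit.QuantumFields.YangMills.Theorems.CovariantDischargeUniformFluxLetters

end
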